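import Summits.QuantumFields.YangMills.Theorems.BalabanUVNodesK3V6Defs
import Summits.QuantumFields.YangMills.Theorems.BalabanUVNodesK3V5StubsLetterForm

/-!
# K3⁸ v6 — BOTH REGISTERED STUB TEXTS (`stub_rates13HV`, `stub_expansion13HV`, skeleton b4e55110ab73e679) ⟺ THEIR READING-FREE LETTER FORMS, once GENERICALLY in the face
# predicate; the two-stub composition of K3⁸ KEYED ON LETTERS; the same for the (B)-FREE shapes

Cell `pub-ymgap` (HUMAN RULING D-0062 Track A; director-ym №210 (δⱽ); dag-lead KEY MAP v2), WIDTH SEAT `pub-ymgap-dag-n27-w1` (gen 4) on NODE n27 (B5 composite).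
`--kind proof --supports stmt-QuantumFields-27366 --as helper` (count-neutral).  THEOREMS ONLY, 0 `def`, 0 `sorry`, standard axioms; `N = 2` (= the stub texts).
Sequel of gen 3's `…K3V5Stub1LetterForm` (p608315) ∕ `…K3V5StubsLetterForm` (p609478) — the v5 letter forms — over this seat's v6 mirror `…K3V6Defs` (p625739): (t-v6) of gen 3's close
(«plan K3 v6 re-cut ⇒ re-key the letter forms on the new mirror»).

WHY.  v6's stub texts are v5's with the last conjunct ∕ the two prefixed faces swapped for the SLOT-keyed `KeyedRatesHolderD4V` ∕ `KeyedExtractionV` ∕ `KeyedCoreEdgeHolderD4V`.  The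
reading `𝔯` enters EITHER text only through `GuardedReadingN16` (= the four pins ∧ node N16's two letter rows, p608315 `guardedReadingN16_iff_pins_letterRows`) and through the bundle
`rrOfRecord 𝔯 ksel`, which under the pins IS the spelled bundle of letters (p608315 `rrOfRecord_eq_of_pins`; p609478 `exists_reading_v5pins_rrOfRecord_eq` ∕
`exists_letters_rrOfRecord_eq_of_guardedReadingN16`).  So the normal form is INDEPENDENT OF THE FACE PREDICATE: §1 proves it ONCE for an arbitrary `P : RateReadingFn → Prop` (stub-1 shape)
and arbitrary `P Q : RateReadingFn → Prop` (stub-2 shape); §2 instantiates at v6's `…V` faces (the REGISTERED texts VERBATIM on the left) and at the `…BFree` shapes; §3 composes K3⁸ BY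
NAME from the letter forms (`K3V6Defs.spineGivenEndpointR13SepCoPHV_of_stubTextsV` ∕ `…_of_stubTextsBFree`).

CONTENTS.  §1 ★ `guardedStubOneShape_iff_letterForm` · ★ `guardedStubTwoShape_iff_letterForm` (generic).  §2 ★★★ `stub1TextV_iff_letterFormV` · ★★★ `stub2TextV_iff_letterFormV` (v6's
registered texts ⟺ letter forms) · `stub1TextBFree_iff_letterFormBFree` · `stub2TextBFree_iff_letterFormBFree`.  §3 `spineGivenEndpointR13SepCoPHV_of_letterFormsV` ·
`spineGivenEndpointR13SepCoPHV_of_letterFormsBFree`.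

HONEST FRAMING.  COMPOSITE-node bookkeeping BY NAME (`Iff`s over one minted reading, compositions); NOT a proof of `stub_rates13HV` or `stub_expansion13HV`; every estimate (THE END's N16
sentence, the kernel letters, the R-β rates with (D4) at every slot datum, NE7b ∕ NE7c ∕ the NE7 core edge ∕ N27x extraction at the spine reading of record) sits INSIDE the letter forms
as a face PREDICATE inhabited for no family today (K0⁷ OPEN; none of NE1′–NE9 in print for d = 4); the minted reading's N14 ∕ N15 components are dag-n14-w1's datum-read tower ∕ dag-n15-a's
MODEL-level family (v5∕v6's own labels); nothing of Bałaban's asserted or instantiated; N14–N22 ∕ N27 NOT discharged; K3⁸ stmt-QuantumFields-27366 OPEN, NOT claimed; skeleton v6 UNTOUCHED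
(plan's); K3⁷ 20544 aside; counts UNMOVED (typed 28∕28 · discharged 5∕27, A 5∕28).  One finite 𝕋⁴ programme at fixed `ε` — R4 closes the CONDITIONAL finite-𝕋⁴ rung `BalabanLadder.UV`
only: NOT continuum ∕ ℝ⁴ ∕ OS ∕ mass gap ∕ Clay; the Yang–Mills mass gap is NOT proved by any of this.
-/

set_option autoImplicit false

noncomputable section

open scoped Matrix.Norms.L2Operator

namespace Summit.QuantumFields.YangMills.Theorems.K3V6Defs

open Literature.MathematicalPhysics.QuantumFieldTheory.Balaban1983to89
open Literature.MathematicalPhysics.QuantumFieldTheory.Balaban1983to89.T4Continuum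
open Literature.MathematicalPhysics.QuantumFieldTheory.Balaban1983to89.Node00.U3OfKernels (objectsOfRecord₁₃)
open Summit.QuantumFields.BalabanUV.T4Continuum
open Summit.QuantumFields.BalabanUV.T4Continuum.Spine
open MinimalActionRate (sfClass)
open YMDAG.UVSplit
open YMDAG.N14.TopBorn (Ne1PinnedOfRecord ne1OfRecord)
open Node00 (Stage13HParams U3Letters₁₁ NE3Letters₁₁ NE3Objects₁₁ RateObjects₁₁ ne3ConstLayerOfRecord₁₁ ne3NperOfRecord₁₁ ne3DomOfRecord₁₁)
open Summit.QuantumFields.YangMills.BalabanUVNodes.N16PinnedLayer13CoPH (N16PinnedLoose N16LettersEnd)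
open Summit.QuantumFields.YangMills.BalabanUVNodes.N15.GenuineRecord (fullGSizedObjects)
open Summit.QuantumFields.YangMills.BalabanUVNodes.N15.AtKeyedHome (neZero_blockFactor)
open Literature.MathematicalPhysics.QuantumFieldTheory.Balaban1983to89.B12Sec2to5 (betaPrime510)
open Literature.MathematicalPhysics.QuantumFieldTheory.Balaban1983to89.Node00.U3KernelLetters (PolLimitsExistOfRecord₁₃ WindowedNE9OfRecord₁₃ WindowedDecayOfRecord₁₃
  WindowedStepRateOfRecord₁₃)
open T4ContinuumYM4Torus (ForSmallCouplings)
open Summit.QuantumFields.YangMills.BalabanUVNodes.N16HolderDefs (N16HolderAt)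
open Summit.QuantumFields.YangMills.Theorems.BalabanUVNodesN27SpineRecord (pHolderD4Body_rateCarriers_of_kernels_pin n22At_kernels_of_letters_guarded n18At_kernels_of_letters_guarded
  kernelDecayOfRecord₁₃_of_letters_guarded)
open Summit.QuantumFields.YangMills.Theorems.K3V5Defs

/-! ## §1 GENERIC: a `GuardedReadingN16`-keyed statement about `rrOfRecord 𝔯 ksel` ⟺ the same statement about the SPELLED BUNDLE OF LETTERS (any face predicate) -/

/-- ★ **THE STUB-1 SHAPE, GENERIC IN THE FACE**: for ANY predicate `P` on rate readings, «SOME reading `𝔯`, selector `ksel` and N16 letters with `GuardedReadingN16 𝔯 ksel ℓ ℓ₃ g B` such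
that `P (rrOfRecord 𝔯 ksel)`» ⟺ «SOME letters (`0 < l₀`, `0 ≤ Λ`, `0 < b`, `0 < a_S`, directions, `c₃₅`, `p`, `ℓ`, `ℓ₃`, `g`, `B`) carrying node N16's two letter rows and SOME selector
such that `P` holds AT THE SPELLED BUNDLE OF LETTERS».  «⇒»: under the pins the bundle IS the spelled one (p609478 `exists_letters_rrOfRecord_eq_of_guardedReadingN16`); «⇐»: mint the
all-pins reading of the letters (p609478 `exists_reading_v5pins_rrOfRecord_eq`), guard from pins (p608315).  Pure bookkeeping; `P` is never opened. [bookkeeping] -/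
theorem guardedStubOneShape_iff_letterForm (ℓ : LetterReading) (P : RateReadingFn → Prop) :
    (∃ (𝔯 : RateReading₁₃CoPH 2) (ksel : RunSel) (ℓ₃ : T4Family → Node00.NE3Letters₁₁) (g B : T4Family → ℝ),
        GuardedReadingN16 𝔯 ksel ℓ ℓ₃ g B ∧ P (rrOfRecord 𝔯 ksel)) ↔
    ∃ (l₀ Λ b aS : ℝ) (ν μ α β' : Fin 4) (c35 p : ℝ) (ℓ₃ : T4Family → NE3Letters₁₁) (g B : T4Family → ℝ) (ksel : RunSel),
        0 < l₀ ∧ 0 ≤ Λ ∧ 0 < b ∧ 0 < aS ∧ N16LettersEnd 2 g ℓ₃ ∧ N16RadiusMatch ℓ₃ B ∧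
        P fun F θ hP g₀ os =>
          ⟨ne1OfRecord l₀ Λ F θ hP g₀ os, ne2OfRecord₁₁ (haveI := neZero_blockFactor F; fullGSizedObjects 3 F.hL b aS ν μ α β' c35 p),
            ne3OfRecord₁₁ F { ne3ConstLayerOfRecord₁₁ F 2 (ℓ₃ F) with
              dom := {V | V ∈ ne3DomOfRecord₁₁ F 2 0 0 ∧ V ∈ sfClass 4 F.L (ne3NperOfRecord₁₁ F 0 0) ((ℓ₃ F).ε / B F) 0} },
            u3OfRecord₁₃ θ.toStage13Params (objectsOfRecord₁₃ F 2 θ.toStage13Params (ℓ F θ)) (ksel F θ hP g₀ os)⟩ := by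
  constructor
  · rintro ⟨𝔯, ksel, ℓ₃, g, B, hG, hK⟩
    obtain ⟨l₀, Λ, b, aS, ν, μ, α, β', c35, p, hl₀, hΛ, hb, haS, hrr⟩ := exists_letters_rrOfRecord_eq_of_guardedReadingN16 hG
    exact ⟨l₀, Λ, b, aS, ν, μ, α, β', c35, p, ℓ₃, g, B, ksel, hl₀, hΛ, hb, haS, hG.2.2.1, hG.2.2.2, (hrr ksel) ▸ hK⟩
  · rintro ⟨l₀, Λ, b, aS, ν, μ, α, β', c35, p, ℓ₃, g, B, ksel, hl₀, hΛ, hb, haS, hE, hM, hK⟩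
    obtain ⟨𝔯, hpins, hrr⟩ := exists_reading_v5pins_rrOfRecord_eq l₀ Λ b aS ν μ α β' c35 p ℓ ℓ₃ B hl₀ hΛ hb haS
    exact ⟨𝔯, ksel, ℓ₃, g, B, (guardedReadingN16_iff_pins_letterRows ksel ℓ ℓ₃ g B).2 ⟨hpins, hE, hM⟩, (hrr ksel).symm ▸ hK⟩

/-- ★ **THE STUB-2 SHAPE, GENERIC IN THE TWO FACES**: for ANY predicates `P Q` on rate readings, «for every guarded reading, `P (rrOfRecord 𝔯 ksel) → Q (rrOfRecord 𝔯 ksel)`» ⟺ «for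
every letter tuple with node N16's two rows and every selector, `P` at the spelled bundle → `Q` at the spelled bundle».  Same two moves as the stub-1 shape. [bookkeeping] -/
theorem guardedStubTwoShape_iff_letterForm (ℓ : LetterReading) (P Q : RateReadingFn → Prop) :
    (∀ (𝔯 : RateReading₁₃CoPH 2) (ksel : RunSel) (ℓ₃ : T4Family → Node00.NE3Letters₁₁) (g B : T4Family → ℝ),
        GuardedReadingN16 𝔯 ksel ℓ ℓ₃ g B → P (rrOfRecord 𝔯 ksel) → Q (rrOfRecord 𝔯 ksel)) ↔
    ∀ (l₀ Λ b aS : ℝ) (ν μ α β' : Fin 4) (c35 p : ℝ) (ℓ₃ : T4Family → NE3Letters₁₁) (g B : T4Family → ℝ) (ksel : RunSel),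
        0 < l₀ → 0 ≤ Λ → 0 < b → 0 < aS → N16LettersEnd 2 g ℓ₃ → N16RadiusMatch ℓ₃ B →
        (P fun F θ hP g₀ os =>
          ⟨ne1OfRecord l₀ Λ F θ hP g₀ os, ne2OfRecord₁₁ (haveI := neZero_blockFactor F; fullGSizedObjects 3 F.hL b aS ν μ α β' c35 p),
            ne3OfRecord₁₁ F { ne3ConstLayerOfRecord₁₁ F 2 (ℓ₃ F) with
              dom := {V | V ∈ ne3DomOfRecord₁₁ F 2 0 0 ∧ V ∈ sfClass 4 F.L (ne3NperOfRecord₁₁ F 0 0) ((ℓ₃ F).ε / B F) 0} },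
            u3OfRecord₁₃ θ.toStage13Params (objectsOfRecord₁₃ F 2 θ.toStage13Params (ℓ F θ)) (ksel F θ hP g₀ os)⟩) →
        Q fun F θ hP g₀ os =>
          ⟨ne1OfRecord l₀ Λ F θ hP g₀ os, ne2OfRecord₁₁ (haveI := neZero_blockFactor F; fullGSizedObjects 3 F.hL b aS ν μ α β' c35 p),
            ne3OfRecord₁₁ F { ne3ConstLayerOfRecord₁₁ F 2 (ℓ₃ F) with
              dom := {V | V ∈ ne3DomOfRecord₁₁ F 2 0 0 ∧ V ∈ sfClass 4 F.L (ne3NperOfRecord₁₁ F 0 0) ((ℓ₃ F).ε / B F) 0} },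
            u3OfRecord₁₃ θ.toStage13Params (objectsOfRecord₁₃ F 2 θ.toStage13Params (ℓ F θ)) (ksel F θ hP g₀ os)⟩ := by
  constructor
  · intro H l₀ Λ b aS ν μ α β' c35 p ℓ₃ g B ksel hl₀ hΛ hb haS hE hM hK
    obtain ⟨𝔯, hpins, hrr⟩ := exists_reading_v5pins_rrOfRecord_eq l₀ Λ b aS ν μ α β' c35 p ℓ ℓ₃ B hl₀ hΛ hb haS
    have hG : GuardedReadingN16 𝔯 ksel ℓ ℓ₃ g B := (guardedReadingN16_iff_pins_letterRows ksel ℓ ℓ₃ g B).2 ⟨hpins, hE, hM⟩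
    have h := H 𝔯 ksel ℓ₃ g B hG ((hrr ksel).symm ▸ hK)
    rw [hrr ksel] at h
    exact h
  · intro H 𝔯 ksel ℓ₃ g B hG hK
    obtain ⟨l₀, Λ, b, aS, ν, μ, α, β', c35, p, hl₀, hΛ, hb, haS, hrr⟩ := exists_letters_rrOfRecord_eq_of_guardedReadingN16 hG
    have h := H l₀ Λ b aS ν μ α β' c35 p ℓ₃ g B ksel hl₀ hΛ hb haS hG.2.2.1 hG.2.2.2 ((hrr ksel) ▸ hK)
    rw [← hrr ksel] at h
    exact h

/-! ## §2 THE REGISTERED v6 TEXTS ⟺ THEIR LETTER FORMS (and the (B)-free shapes) -/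

/-- ★★★ **v6 STUB 1's TEXT ⟺ ITS LETTER NORMAL FORM.**  `stub_rates13HV`'s text (left, VERBATIM over the mirrored names) holds iff for SOME `β ∈ ]2/3, 1[`, SOME letters with node N16's
two rows and SOME selector, the SLOT-keyed rates `KeyedRatesHolderD4V β` hold AT THE SPELLED BUNDLE OF LETTERS — no rate reading, no guard in the statement.  (§1 at
`P := KeyedRatesHolderD4V β`, under `∃ β`; letter order as in gen 3's v5 letter form.)  NOT a proof of the stub. [bookkeeping] -/
theorem stub1TextV_iff_letterFormV :
    (∃ β : ℝ, 2 / 3 < β ∧ β < 1 ∧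
    ∃ (𝔯 : RateReading₁₃CoPH 2) (ksel : RunSel) (ℓ : LetterReading) (ℓ₃ : T4Family → Node00.NE3Letters₁₁) (g B : T4Family → ℝ),
      GuardedReadingN16 𝔯 ksel ℓ ℓ₃ g B ∧ KeyedRatesHolderD4V β (rrOfRecord 𝔯 ksel)) ↔
    ∃ β : ℝ, 2 / 3 < β ∧ β < 1 ∧
      ∃ (l₀ Λ b aS : ℝ) (ν μ α β' : Fin 4) (c35 p : ℝ) (ℓ : LetterReading) (ℓ₃ : T4Family → NE3Letters₁₁) (g B : T4Family → ℝ) (ksel : RunSel),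
        0 < l₀ ∧ 0 ≤ Λ ∧ 0 < b ∧ 0 < aS ∧ N16LettersEnd 2 g ℓ₃ ∧ N16RadiusMatch ℓ₃ B ∧
        KeyedRatesHolderD4V β fun F θ hP g₀ os =>
          ⟨ne1OfRecord l₀ Λ F θ hP g₀ os, ne2OfRecord₁₁ (haveI := neZero_blockFactor F; fullGSizedObjects 3 F.hL b aS ν μ α β' c35 p),
            ne3OfRecord₁₁ F { ne3ConstLayerOfRecord₁₁ F 2 (ℓ₃ F) with
              dom := {V | V ∈ ne3DomOfRecord₁₁ F 2 0 0 ∧ V ∈ sfClass 4 F.L (ne3NperOfRecord₁₁ F 0 0) ((ℓ₃ F).ε / B F) 0} },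
            u3OfRecord₁₃ θ.toStage13Params (objectsOfRecord₁₃ F 2 θ.toStage13Params (ℓ F θ)) (ksel F θ hP g₀ os)⟩ := by
  refine exists_congr fun β => and_congr_right fun _ => and_congr_right fun _ => ?_
  constructor
  · rintro ⟨𝔯, ksel, ℓ, ℓ₃, g, B, hG, hK⟩
    obtain ⟨l₀, Λ, b, aS, ν, μ, α, β', c35, p, ℓ₃', g', B', ksel', h⟩ := (guardedStubOneShape_iff_letterForm ℓ (KeyedRatesHolderD4V β)).1 ⟨𝔯, ksel, ℓ₃, g, B, hG, hK⟩
    exact ⟨l₀, Λ, b, aS, ν, μ, α, β', c35, p, ℓ, ℓ₃', g', B', ksel', h⟩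
  · rintro ⟨l₀, Λ, b, aS, ν, μ, α, β', c35, p, ℓ, ℓ₃, g, B, ksel, h⟩
    obtain ⟨𝔯, ksel', ℓ₃', g', B', hG, hK⟩ := (guardedStubOneShape_iff_letterForm ℓ (KeyedRatesHolderD4V β)).2 ⟨l₀, Λ, b, aS, ν, μ, α, β', c35, p, ℓ₃, g, B, ksel, h⟩
    exact ⟨𝔯, ksel', ℓ, ℓ₃', g', B', hG, hK⟩

/-- ★★★ **v6 STUB 2's TEXT ⟺ ITS LETTER FORM.**  `stub_expansion13HV`'s text (left, VERBATIM over the mirrored names) holds iff: for every `β ∈ ]2/3, 1[`, every letter tuple with node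
N16's two rows and every selector, the SLOT-keyed rates `KeyedRatesHolderD4V β` AT THE SPELLED BUNDLE imply SOME `jc sh cr` with `PinnedAtLive jc sh cr ∧ KeyedRelWeight cr ∧
KeyedShellWeight cr ∧ KeyedExtractionV cr ∧ KeyedCoreEdgeHolderD4V β cr (spelled bundle)`.  (§1 at `P := KeyedRatesHolderD4V β`, `Q := the ∃ jc sh cr …` face conjunction.)  NOT a proof of
the stub. [bookkeeping] -/
theorem stub2TextV_iff_letterFormV :
    (∀ β : ℝ, 2 / 3 < β → β < 1 →
    ∀ (𝔯 : RateReading₁₃CoPH 2) (ksel : RunSel) (ℓ : LetterReading) (ℓ₃ : T4Family → Node00.NE3Letters₁₁) (g B : T4Family → ℝ),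
      GuardedReadingN16 𝔯 ksel ℓ ℓ₃ g B → KeyedRatesHolderD4V β (rrOfRecord 𝔯 ksel) →
      ∃ (jc : CutReading) (sh : ShellSplit₁₃CoPH 2 0) (cr : SpineReading), PinnedAtLive jc sh cr ∧
        KeyedRelWeight cr ∧ KeyedShellWeight cr ∧ KeyedExtractionV cr ∧ KeyedCoreEdgeHolderD4V β cr (rrOfRecord 𝔯 ksel)) ↔
    ∀ β : ℝ, 2 / 3 < β → β < 1 →
      ∀ (l₀ Λ b aS : ℝ) (ν μ α β' : Fin 4) (c35 p : ℝ) (ℓ : LetterReading) (ℓ₃ : T4Family → NE3Letters₁₁) (g B : T4Family → ℝ) (ksel : RunSel),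
        0 < l₀ → 0 ≤ Λ → 0 < b → 0 < aS → N16LettersEnd 2 g ℓ₃ → N16RadiusMatch ℓ₃ B →
        (KeyedRatesHolderD4V β fun F θ hP g₀ os =>
          ⟨ne1OfRecord l₀ Λ F θ hP g₀ os, ne2OfRecord₁₁ (haveI := neZero_blockFactor F; fullGSizedObjects 3 F.hL b aS ν μ α β' c35 p),
            ne3OfRecord₁₁ F { ne3ConstLayerOfRecord₁₁ F 2 (ℓ₃ F) with
              dom := {V | V ∈ ne3DomOfRecord₁₁ F 2 0 0 ∧ V ∈ sfClass 4 F.L (ne3NperOfRecord₁₁ F 0 0) ((ℓ₃ F).ε / B F) 0} },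
            u3OfRecord₁₃ θ.toStage13Params (objectsOfRecord₁₃ F 2 θ.toStage13Params (ℓ F θ)) (ksel F θ hP g₀ os)⟩) →
        ∃ (jc : CutReading) (sh : ShellSplit₁₃CoPH 2 0) (cr : SpineReading), PinnedAtLive jc sh cr ∧
          KeyedRelWeight cr ∧ KeyedShellWeight cr ∧ KeyedExtractionV cr ∧
          KeyedCoreEdgeHolderD4V β cr fun F θ hP g₀ os =>
            ⟨ne1OfRecord l₀ Λ F θ hP g₀ os, ne2OfRecord₁₁ (haveI := neZero_blockFactor F; fullGSizedObjects 3 F.hL b aS ν μ α β' c35 p),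
              ne3OfRecord₁₁ F { ne3ConstLayerOfRecord₁₁ F 2 (ℓ₃ F) with
                dom := {V | V ∈ ne3DomOfRecord₁₁ F 2 0 0 ∧ V ∈ sfClass 4 F.L (ne3NperOfRecord₁₁ F 0 0) ((ℓ₃ F).ε / B F) 0} },
              u3OfRecord₁₃ θ.toStage13Params (objectsOfRecord₁₃ F 2 θ.toStage13Params (ℓ F θ)) (ksel F θ hP g₀ os)⟩ := by
  refine forall_congr' fun β => forall_congr' fun _ => forall_congr' fun _ => ?_
  constructor
  · intro H l₀ Λ b aS ν μ α β' c35 p ℓ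
    exact (guardedStubTwoShape_iff_letterForm ℓ (KeyedRatesHolderD4V β) fun rr => ∃ (jc : CutReading) (sh : ShellSplit₁₃CoPH 2 0) (cr : SpineReading),
      PinnedAtLive jc sh cr ∧ KeyedRelWeight cr ∧ KeyedShellWeight cr ∧ KeyedExtractionV cr ∧ KeyedCoreEdgeHolderD4V β cr rr).1 (fun 𝔯 ksel ℓ₃ g B => H 𝔯 ksel ℓ ℓ₃ g B)
      l₀ Λ b aS ν μ α β' c35 p
  · intro H 𝔯 ksel ℓ
    exact (guardedStubTwoShape_iff_letterForm ℓ (KeyedRatesHolderD4V β) fun rr => ∃ (jc : CutReading) (sh : ShellSplit₁₃CoPH 2 0) (cr : SpineReading),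
      PinnedAtLive jc sh cr ∧ KeyedRelWeight cr ∧ KeyedShellWeight cr ∧ KeyedExtractionV cr ∧ KeyedCoreEdgeHolderD4V β cr rr).2 (fun l₀ Λ b aS ν μ α β' c35 p => H l₀ Λ b aS ν μ α β' c35 p ℓ) 𝔯 ksel

/-- **STUB 1's (B)-FREE SHAPE ⟺ ITS LETTER FORM** (§1 at `P := KeyedRatesHolderD4BFree β`) — the shape a (B)-blind road proves, which transfers to every slot by
`K3V6Defs.keyedRatesHolderD4V_of_bFree`. [bookkeeping] -/
theorem stub1TextBFree_iff_letterFormBFree :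
    (∃ β : ℝ, 2 / 3 < β ∧ β < 1 ∧
    ∃ (𝔯 : RateReading₁₃CoPH 2) (ksel : RunSel) (ℓ : LetterReading) (ℓ₃ : T4Family → Node00.NE3Letters₁₁) (g B : T4Family → ℝ),
      GuardedReadingN16 𝔯 ksel ℓ ℓ₃ g B ∧ KeyedRatesHolderD4BFree β (rrOfRecord 𝔯 ksel)) ↔
    ∃ β : ℝ, 2 / 3 < β ∧ β < 1 ∧
      ∃ (l₀ Λ b aS : ℝ) (ν μ α β' : Fin 4) (c35 p : ℝ) (ℓ : LetterReading) (ℓ₃ : T4Family → NE3Letters₁₁) (g B : T4Family → ℝ) (ksel : RunSel),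
        0 < l₀ ∧ 0 ≤ Λ ∧ 0 < b ∧ 0 < aS ∧ N16LettersEnd 2 g ℓ₃ ∧ N16RadiusMatch ℓ₃ B ∧
        KeyedRatesHolderD4BFree β fun F θ hP g₀ os =>
          ⟨ne1OfRecord l₀ Λ F θ hP g₀ os, ne2OfRecord₁₁ (haveI := neZero_blockFactor F; fullGSizedObjects 3 F.hL b aS ν μ α β' c35 p),
            ne3OfRecord₁₁ F { ne3ConstLayerOfRecord₁₁ F 2 (ℓ₃ F) with
              dom := {V | V ∈ ne3DomOfRecord₁₁ F 2 0 0 ∧ V ∈ sfClass 4 F.L (ne3NperOfRecord₁₁ F 0 0) ((ℓ₃ F).ε / B F) 0} },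
            u3OfRecord₁₃ θ.toStage13Params (objectsOfRecord₁₃ F 2 θ.toStage13Params (ℓ F θ)) (ksel F θ hP g₀ os)⟩ := by
  refine exists_congr fun β => and_congr_right fun _ => and_congr_right fun _ => ?_
  constructor
  · rintro ⟨𝔯, ksel, ℓ, ℓ₃, g, B, hG, hK⟩
    obtain ⟨l₀, Λ, b, aS, ν, μ, α, β', c35, p, ℓ₃', g', B', ksel', h⟩ := (guardedStubOneShape_iff_letterForm ℓ (KeyedRatesHolderD4BFree β)).1 ⟨𝔯, ksel, ℓ₃, g, B, hG, hK⟩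
    exact ⟨l₀, Λ, b, aS, ν, μ, α, β', c35, p, ℓ, ℓ₃', g', B', ksel', h⟩
  · rintro ⟨l₀, Λ, b, aS, ν, μ, α, β', c35, p, ℓ, ℓ₃, g, B, ksel, h⟩
    obtain ⟨𝔯, ksel', ℓ₃', g', B', hG, hK⟩ := (guardedStubOneShape_iff_letterForm ℓ (KeyedRatesHolderD4BFree β)).2 ⟨l₀, Λ, b, aS, ν, μ, α, β', c35, p, ℓ₃, g, B, ksel, h⟩
    exact ⟨𝔯, ksel', ℓ, ℓ₃', g', B', hG, hK⟩

/-- **STUB 2's (B)-FREE SHAPE ⟺ ITS LETTER FORM** (§1 at `P := KeyedRatesHolderD4BFree β`, `Q :=` the face conjunction with `KeyedExtractionBFree` ∕ `KeyedCoreEdgeHolderD4BFree`).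
[bookkeeping] -/
theorem stub2TextBFree_iff_letterFormBFree :
    (∀ β : ℝ, 2 / 3 < β → β < 1 →
    ∀ (𝔯 : RateReading₁₃CoPH 2) (ksel : RunSel) (ℓ : LetterReading) (ℓ₃ : T4Family → Node00.NE3Letters₁₁) (g B : T4Family → ℝ),
      GuardedReadingN16 𝔯 ksel ℓ ℓ₃ g B → KeyedRatesHolderD4BFree β (rrOfRecord 𝔯 ksel) →
      ∃ (jc : CutReading) (sh : ShellSplit₁₃CoPH 2 0) (cr : SpineReading), PinnedAtLive jc sh cr ∧
        KeyedRelWeight cr ∧ KeyedShellWeight cr ∧ KeyedExtractionBFree cr ∧ KeyedCoreEdgeHolderD4BFree β cr (rrOfRecord 𝔯 ksel)) ↔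
    ∀ β : ℝ, 2 / 3 < β → β < 1 →
      ∀ (l₀ Λ b aS : ℝ) (ν μ α β' : Fin 4) (c35 p : ℝ) (ℓ : LetterReading) (ℓ₃ : T4Family → NE3Letters₁₁) (g B : T4Family → ℝ) (ksel : RunSel),
        0 < l₀ → 0 ≤ Λ → 0 < b → 0 < aS → N16LettersEnd 2 g ℓ₃ → N16RadiusMatch ℓ₃ B →
        (KeyedRatesHolderD4BFree β fun F θ hP g₀ os =>
          ⟨ne1OfRecord l₀ Λ F θ hP g₀ os, ne2OfRecord₁₁ (haveI := neZero_blockFactor F; fullGSizedObjects 3 F.hL b aS ν μ α β' c35 p),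
            ne3OfRecord₁₁ F { ne3ConstLayerOfRecord₁₁ F 2 (ℓ₃ F) with
              dom := {V | V ∈ ne3DomOfRecord₁₁ F 2 0 0 ∧ V ∈ sfClass 4 F.L (ne3NperOfRecord₁₁ F 0 0) ((ℓ₃ F).ε / B F) 0} },
            u3OfRecord₁₃ θ.toStage13Params (objectsOfRecord₁₃ F 2 θ.toStage13Params (ℓ F θ)) (ksel F θ hP g₀ os)⟩) →
        ∃ (jc : CutReading) (sh : ShellSplit₁₃CoPH 2 0) (cr : SpineReading), PinnedAtLive jc sh cr ∧
          KeyedRelWeight cr ∧ KeyedShellWeight cr ∧ KeyedExtractionBFree cr ∧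
          KeyedCoreEdgeHolderD4BFree β cr fun F θ hP g₀ os =>
            ⟨ne1OfRecord l₀ Λ F θ hP g₀ os, ne2OfRecord₁₁ (haveI := neZero_blockFactor F; fullGSizedObjects 3 F.hL b aS ν μ α β' c35 p),
              ne3OfRecord₁₁ F { ne3ConstLayerOfRecord₁₁ F 2 (ℓ₃ F) with
                dom := {V | V ∈ ne3DomOfRecord₁₁ F 2 0 0 ∧ V ∈ sfClass 4 F.L (ne3NperOfRecord₁₁ F 0 0) ((ℓ₃ F).ε / B F) 0} },
              u3OfRecord₁₃ θ.toStage13Params (objectsOfRecord₁₃ F 2 θ.toStage13Params (ℓ F θ)) (ksel F θ hP g₀ os)⟩ := by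
  refine forall_congr' fun β => forall_congr' fun _ => forall_congr' fun _ => ?_
  constructor
  · intro H l₀ Λ b aS ν μ α β' c35 p ℓ
    exact (guardedStubTwoShape_iff_letterForm ℓ (KeyedRatesHolderD4BFree β) fun rr => ∃ (jc : CutReading) (sh : ShellSplit₁₃CoPH 2 0) (cr : SpineReading),
      PinnedAtLive jc sh cr ∧ KeyedRelWeight cr ∧ KeyedShellWeight cr ∧ KeyedExtractionBFree cr ∧ KeyedCoreEdgeHolderD4BFree β cr rr).1 (fun 𝔯 ksel ℓ₃ g B => H 𝔯 ksel ℓ ℓ₃ g B)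
      l₀ Λ b aS ν μ α β' c35 p
  · intro H 𝔯 ksel ℓ
    exact (guardedStubTwoShape_iff_letterForm ℓ (KeyedRatesHolderD4BFree β) fun rr => ∃ (jc : CutReading) (sh : ShellSplit₁₃CoPH 2 0) (cr : SpineReading),
      PinnedAtLive jc sh cr ∧ KeyedRelWeight cr ∧ KeyedShellWeight cr ∧ KeyedExtractionBFree cr ∧ KeyedCoreEdgeHolderD4BFree β cr rr).2 (fun l₀ Λ b aS ν μ α β' c35 p => H l₀ Λ b aS ν μ α β' c35 p ℓ) 𝔯 ksel

/-! ## §3 K3⁸ keyed on letters -/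

/-- **K3⁸ BY NAME FROM THE TWO v6 LETTER FORMS** (v6's composition `stub 1 → stub 2 → K3⁸` re-keyed on the letter tuple: §2's two `iff`s feed `K3V6Defs.spineGivenEndpointR13SepCoPHV_of_stubTextsV`).
NOT a proof of either stub; every estimate sits inside the two hypotheses. [bookkeeping] -/
theorem spineGivenEndpointR13SepCoPHV_of_letterFormsV
    (h₁ : ∃ β : ℝ, 2 / 3 < β ∧ β < 1 ∧
      ∃ (l₀ Λ b aS : ℝ) (ν μ α β' : Fin 4) (c35 p : ℝ) (ℓ : LetterReading) (ℓ₃ : T4Family → NE3Letters₁₁) (g B : T4Family → ℝ) (ksel : RunSel),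
        0 < l₀ ∧ 0 ≤ Λ ∧ 0 < b ∧ 0 < aS ∧ N16LettersEnd 2 g ℓ₃ ∧ N16RadiusMatch ℓ₃ B ∧
        KeyedRatesHolderD4V β fun F θ hP g₀ os =>
          ⟨ne1OfRecord l₀ Λ F θ hP g₀ os, ne2OfRecord₁₁ (haveI := neZero_blockFactor F; fullGSizedObjects 3 F.hL b aS ν μ α β' c35 p),
            ne3OfRecord₁₁ F { ne3ConstLayerOfRecord₁₁ F 2 (ℓ₃ F) with
              dom := {V | V ∈ ne3DomOfRecord₁₁ F 2 0 0 ∧ V ∈ sfClass 4 F.L (ne3NperOfRecord₁₁ F 0 0) ((ℓ₃ F).ε / B F) 0} },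
            u3OfRecord₁₃ θ.toStage13Params (objectsOfRecord₁₃ F 2 θ.toStage13Params (ℓ F θ)) (ksel F θ hP g₀ os)⟩)
    (h₂ : ∀ β : ℝ, 2 / 3 < β → β < 1 →
      ∀ (l₀ Λ b aS : ℝ) (ν μ α β' : Fin 4) (c35 p : ℝ) (ℓ : LetterReading) (ℓ₃ : T4Family → NE3Letters₁₁) (g B : T4Family → ℝ) (ksel : RunSel),
        0 < l₀ → 0 ≤ Λ → 0 < b → 0 < aS → N16LettersEnd 2 g ℓ₃ → N16RadiusMatch ℓ₃ B →
        (KeyedRatesHolderD4V β fun F θ hP g₀ os =>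
          ⟨ne1OfRecord l₀ Λ F θ hP g₀ os, ne2OfRecord₁₁ (haveI := neZero_blockFactor F; fullGSizedObjects 3 F.hL b aS ν μ α β' c35 p),
            ne3OfRecord₁₁ F { ne3ConstLayerOfRecord₁₁ F 2 (ℓ₃ F) with
              dom := {V | V ∈ ne3DomOfRecord₁₁ F 2 0 0 ∧ V ∈ sfClass 4 F.L (ne3NperOfRecord₁₁ F 0 0) ((ℓ₃ F).ε / B F) 0} },
            u3OfRecord₁₃ θ.toStage13Params (objectsOfRecord₁₃ F 2 θ.toStage13Params (ℓ F θ)) (ksel F θ hP g₀ os)⟩) →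
        ∃ (jc : CutReading) (sh : ShellSplit₁₃CoPH 2 0) (cr : SpineReading), PinnedAtLive jc sh cr ∧
          KeyedRelWeight cr ∧ KeyedShellWeight cr ∧ KeyedExtractionV cr ∧
          KeyedCoreEdgeHolderD4V β cr fun F θ hP g₀ os =>
            ⟨ne1OfRecord l₀ Λ F θ hP g₀ os, ne2OfRecord₁₁ (haveI := neZero_blockFactor F; fullGSizedObjects 3 F.hL b aS ν μ α β' c35 p),
              ne3OfRecord₁₁ F { ne3ConstLayerOfRecord₁₁ F 2 (ℓ₃ F) with
                dom := {V | V ∈ ne3DomOfRecord₁₁ F 2 0 0 ∧ V ∈ sfClass 4 F.L (ne3NperOfRecord₁₁ F 0 0) ((ℓ₃ F).ε / B F) 0} },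
              u3OfRecord₁₃ θ.toStage13Params (objectsOfRecord₁₃ F 2 θ.toStage13Params (ℓ F θ)) (ksel F θ hP g₀ os)⟩) :
    Summit.QuantumFields.YangMills.Theses.BalabanUVNodes.SpineGivenEndpointR13SepCoPHV :=
  spineGivenEndpointR13SepCoPHV_of_stubTextsV (stub1TextV_iff_letterFormV.2 h₁) (stub2TextV_iff_letterFormV.2 h₂)

/-- **K3⁸ BY NAME FROM THE TWO (B)-FREE LETTER FORMS** (§2's (B)-free `iff`s feed `K3V6Defs.spineGivenEndpointR13SepCoPHV_of_stubTextsBFree`): the reading-free, (B)-free normal form of the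
whole K3⁸ line — what a (B)-blind supplier of both stubs proves, at the letters.  NOT a proof of either stub. [bookkeeping] -/
theorem spineGivenEndpointR13SepCoPHV_of_letterFormsBFree
    (h₁ : ∃ β : ℝ, 2 / 3 < β ∧ β < 1 ∧
      ∃ (l₀ Λ b aS : ℝ) (ν μ α β' : Fin 4) (c35 p : ℝ) (ℓ : LetterReading) (ℓ₃ : T4Family → NE3Letters₁₁) (g B : T4Family → ℝ) (ksel : RunSel),
        0 < l₀ ∧ 0 ≤ Λ ∧ 0 < b ∧ 0 < aS ∧ N16LettersEnd 2 g ℓ₃ ∧ N16RadiusMatch ℓ₃ B ∧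
        KeyedRatesHolderD4BFree β fun F θ hP g₀ os =>
          ⟨ne1OfRecord l₀ Λ F θ hP g₀ os, ne2OfRecord₁₁ (haveI := neZero_blockFactor F; fullGSizedObjects 3 F.hL b aS ν μ α β' c35 p),
            ne3OfRecord₁₁ F { ne3ConstLayerOfRecord₁₁ F 2 (ℓ₃ F) with
              dom := {V | V ∈ ne3DomOfRecord₁₁ F 2 0 0 ∧ V ∈ sfClass 4 F.L (ne3NperOfRecord₁₁ F 0 0) ((ℓ₃ F).ε / B F) 0} },
            u3OfRecord₁₃ θ.toStage13Params (objectsOfRecord₁₃ F 2 θ.toStage13Params (ℓ F θ)) (ksel F θ hP g₀ os)⟩)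
    (h₂ : ∀ β : ℝ, 2 / 3 < β → β < 1 →
      ∀ (l₀ Λ b aS : ℝ) (ν μ α β' : Fin 4) (c35 p : ℝ) (ℓ : LetterReading) (ℓ₃ : T4Family → NE3Letters₁₁) (g B : T4Family → ℝ) (ksel : RunSel),
        0 < l₀ → 0 ≤ Λ → 0 < b → 0 < aS → N16LettersEnd 2 g ℓ₃ → N16RadiusMatch ℓ₃ B →
        (KeyedRatesHolderD4BFree β fun F θ hP g₀ os =>
          ⟨ne1OfRecord l₀ Λ F θ hP g₀ os, ne2OfRecord₁₁ (haveI := neZero_blockFactor F; fullGSizedObjects 3 F.hL b aS ν μ α β' c35 p),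
            ne3OfRecord₁₁ F { ne3ConstLayerOfRecord₁₁ F 2 (ℓ₃ F) with
              dom := {V | V ∈ ne3DomOfRecord₁₁ F 2 0 0 ∧ V ∈ sfClass 4 F.L (ne3NperOfRecord₁₁ F 0 0) ((ℓ₃ F).ε / B F) 0} },
            u3OfRecord₁₃ θ.toStage13Params (objectsOfRecord₁₃ F 2 θ.toStage13Params (ℓ F θ)) (ksel F θ hP g₀ os)⟩) →
        ∃ (jc : CutReading) (sh : ShellSplit₁₃CoPH 2 0) (cr : SpineReading), PinnedAtLive jc sh cr ∧
          KeyedRelWeight cr ∧ KeyedShellWeight cr ∧ KeyedExtractionBFree cr ∧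
          KeyedCoreEdgeHolderD4BFree β cr fun F θ hP g₀ os =>
            ⟨ne1OfRecord l₀ Λ F θ hP g₀ os, ne2OfRecord₁₁ (haveI := neZero_blockFactor F; fullGSizedObjects 3 F.hL b aS ν μ α β' c35 p),
              ne3OfRecord₁₁ F { ne3ConstLayerOfRecord₁₁ F 2 (ℓ₃ F) with
                dom := {V | V ∈ ne3DomOfRecord₁₁ F 2 0 0 ∧ V ∈ sfClass 4 F.L (ne3NperOfRecord₁₁ F 0 0) ((ℓ₃ F).ε / B F) 0} },
              u3OfRecord₁₃ θ.toStage13Params (objectsOfRecord₁₃ F 2 θ.toStage13Params (ℓ F θ)) (ksel F θ hP g₀ os)⟩) :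
    Summit.QuantumFields.YangMills.Theses.BalabanUVNodes.SpineGivenEndpointR13SepCoPHV :=
  spineGivenEndpointR13SepCoPHV_of_stubTextsBFree (stub1TextBFree_iff_letterFormBFree.2 h₁) (stub2TextBFree_iff_letterFormBFree.2 h₂)

/-! ## §4 The (B)-FREE bill of stub 1's rates conjunct from the rows — its slot edition by transfer — v6 STUB 1's TEXT and K3⁸ from the rows -/

section Rows

variable (𝔯 : RateReading₁₃CoPH 2) (ksel : RunSel) (ℓ : LetterReading) (ℓ₃ : T4Family → Node00.NE3Letters₁₁) (g B : T4Family → ℝ) (β : ℝ)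
  (s : (F : T4Family) → Stage13HParams F 2 → ℕ)
  -- N16 at exponent β at the LOOSE-DATA object, one sentence per guarded family (THE END's content; module 43 §4 ∕ p602214 supply it)
  (h16 : ∀ (F : T4Family), (∃ θ : Stage13HParams F 2, θ.Provisos₁₃CoPH F 2 ∧ (θ.ZhUnity F 2 ∧ θ.SlotsNondegenerate₁₃ F 2) ∧ θ.Admissible F 2) →
    N16HolderAt (ne3OfRecord₁₁ F { ne3ConstLayerOfRecord₁₁ F 2 (ℓ₃ F) with
      dom := {V | V ∈ ne3DomOfRecord₁₁ F 2 0 0 ∧ V ∈ sfClass 4 F.L (ne3NperOfRecord₁₁ F 0 0) ((ℓ₃ F).ε / B F) 0} }) β)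
  -- the U3 letter block's rows
  (hs : ∀ (F : T4Family) (θ : Stage13HParams F 2), θ.Provisos₁₃CoPH F 2 → (θ.ZhUnity F 2 ∧ θ.SlotsNondegenerate₁₃ F 2) → θ.Admissible F 2 → (ℓ F θ).Signs)
  (hκ : ∀ (F : T4Family) (θ : Stage13HParams F 2), θ.Provisos₁₃CoPH F 2 → (θ.ZhUnity F 2 ∧ θ.SlotsNondegenerate₁₃ F 2) → θ.Admissible F 2 → 0 < (ℓ F θ).κ)
  (hcr : ∀ (F : T4Family) (θ : Stage13HParams F 2), θ.Provisos₁₃CoPH F 2 → (θ.ZhUnity F 2 ∧ θ.SlotsNondegenerate₁₃ F 2) → θ.Admissible F 2 → betaPrime510 4 1 (ℓ F θ).κ ≤ (ℓ F θ).cr)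
  (hρ : ∀ (F : T4Family) (θ : Stage13HParams F 2), θ.Provisos₁₃CoPH F 2 → (θ.ZhUnity F 2 ∧ θ.SlotsNondegenerate₁₃ F 2) → θ.Admissible F 2 → 0 ≤ (ℓ F θ).ρ ∧ (ℓ F θ).ρ < 1)
  -- def-W1's four finite-volume kernel letters of record
  (hL : ∀ (F : T4Family) (θ : Stage13HParams F 2), θ.Provisos₁₃CoPH F 2 → (θ.ZhUnity F 2 ∧ θ.SlotsNondegenerate₁₃ F 2) → θ.Admissible F 2 → PolLimitsExistOfRecord₁₃ F 2 θ.toStage13Params)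
  (h9 : ∀ (F : T4Family) (θ : Stage13HParams F 2), θ.Provisos₁₃CoPH F 2 → (θ.ZhUnity F 2 ∧ θ.SlotsNondegenerate₁₃ F 2) → θ.Admissible F 2 →
    WindowedNE9OfRecord₁₃ F 2 θ.toStage13Params (ℓ F θ).κ (ℓ F θ).moduli)
  (hW : ∀ (F : T4Family) (θ : Stage13HParams F 2), θ.Provisos₁₃CoPH F 2 → (θ.ZhUnity F 2 ∧ θ.SlotsNondegenerate₁₃ F 2) → θ.Admissible F 2 →
    WindowedDecayOfRecord₁₃ F 2 θ.toStage13Params 0 1 (ℓ F θ).κ)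
  (hS : ∀ (F : T4Family) (θ : Stage13HParams F 2), θ.Provisos₁₃CoPH F 2 → (θ.ZhUnity F 2 ∧ θ.SlotsNondegenerate₁₃ F 2) → θ.Admissible F 2 →
    WindowedStepRateOfRecord₁₃ F 2 θ.toStage13Params (s F θ) (ℓ F θ).κ (ℓ F θ).θ₅ ((ℓ F θ).C₅ * (ℓ F θ).θ₅))

section Bill

variable (hG : GuardedReadingN16 𝔯 ksel ℓ ℓ₃ g B)
include hG h16 hs hκ hcr hρ hL h9 hW hS

/-- ★★ **STUB 1's RATES CONJUNCT IN ITS (B)-FREE SHAPE, AT THE PINNED READING OF RECORD, FROM THE ROWS** — gen 2's bill `K3V5Defs.keyedRatesHolderD4_rrOfRecord_of_pins_of_letters` (p606160 §3)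
with the two discarded prefix binders `_ _` simply not introduced: GIVEN `GuardedReadingN16 𝔯 ksel ℓ ℓ₃ g B` (only its four PINS are read), `KeyedRatesHolderD4BFree β (rrOfRecord 𝔯 ksel)`
follows from ONE `N16HolderAt … β` per guarded family at the loose-data object, def-W1's four kernel letters and the letter rows — per tuple by (Kꜰ) `pHolderD4Body_rateCarriers_of_kernels_pin`,
lifted by `ForSmallCouplings.of_forall` (the rows hold at EVERY `g₀`; (B) and END are never read — which is the point).  Every row a HYPOTHESIS; NOT a proof of the stub. [bookkeeping] -/
theorem keyedRatesHolderD4BFree_rrOfRecord_of_pins_of_letters : KeyedRatesHolderD4BFree β (rrOfRecord 𝔯 ksel) := by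
  obtain ⟨⟨hpin1, -, hpin2, hpin⟩, hpinL, -, -⟩ := hG
  obtain ⟨b, aS, ν, μ, α, β', c35, p, hb, haS, h2⟩ := hpin2
  intro F θ hP hGd hθ
  refine ForSmallCouplings.of_forall fun g₀ os => ?_
  refine pHolderD4Body_rateCarriers_of_kernels_pin 𝔯 θ hP g₀ os (ℓ F θ) (hpin F θ hP g₀ os) β (ksel F θ hP g₀ os)
    (YMDAG.N14.TopBorn.n14At_rateCarriersOfRecord₁₃CoPH_of_pinned 𝔯 hpin1 F θ hP g₀ os (ksel F θ hP g₀ os)) ?_ ?_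
    (hs F θ hP hGd hθ) (hκ F θ hP hGd hθ) (hcr F θ hP hGd hθ) (hρ F θ hP hGd hθ)
    (kernelDecayOfRecord₁₃_of_letters_guarded (fun F θ => θ.ZhUnity F 2 ∧ θ.SlotsNondegenerate₁₃ F 2) ℓ hL hW F θ hP hGd hθ)
    (n18At_kernels_of_letters_guarded (fun F θ => θ.ZhUnity F 2 ∧ θ.SlotsNondegenerate₁₃ F 2) ℓ s hL hS F θ hP hGd hθ _)
    (n22At_kernels_of_letters_guarded (fun F θ => θ.ZhUnity F 2 ∧ θ.SlotsNondegenerate₁₃ F 2) ℓ hs hL h9 F θ hP hGd hθ _)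
  · rw [h2 F θ hP g₀ os]
    exact Summit.QuantumFields.YangMills.BalabanUVNodes.N15.GenuineRecord.n15At_fullGSizedObjects_family hb haS ν μ α β' c35 p F
  · show N16HolderAt (rateCarriersOfRecord₁₃CoPH 𝔯 F θ hP g₀ os (ksel F θ hP g₀ os)).ne3 β
    rw [Summit.QuantumFields.YangMills.BalabanUVNodes.N16PinnedLayer13CoPH.rateCarriers_ne3_of_pinnedLoose hpinL]
    exact h16 F ⟨θ, hP, hGd, hθ⟩

/-- ★★ **… HENCE v6 STUB 1's RATES CONJUNCT `KeyedRatesHolderD4V β (rrOfRecord 𝔯 ksel)` AT EVERY VERSION SLOT, FROM THE SAME ROWS** (`K3V6Defs.keyedRatesHolderD4V_of_bFree`: the (δⱽ)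
recipe «a (B)-free road transfers to every slot verbatim», exercised on gen 2's bill).  Every row a HYPOTHESIS; NOT a proof of the stub. [bookkeeping] -/
theorem keyedRatesHolderD4V_rrOfRecord_of_pins_of_letters : KeyedRatesHolderD4V β (rrOfRecord 𝔯 ksel) :=
  keyedRatesHolderD4V_of_bFree (keyedRatesHolderD4BFree_rrOfRecord_of_pins_of_letters 𝔯 ksel ℓ ℓ₃ g B β s h16 hs hκ hcr hρ hL h9 hW hS hG)

end Bill

variable (hβ : 2 / 3 < β) (hβ' : β < 1) (hE : N16LettersEnd 2 g ℓ₃) (hM : N16RadiusMatch ℓ₃ B)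
include hβ hβ' hE hM h16 hs hκ hcr hρ hL h9 hW hS

/-- ★★★ **v6 STUB 1's TEXT FROM THE ROWS.**  The REGISTERED `stub_rates13HV` text VERBATIM (over the mirrored names) from: an exponent `β ∈ ]2/3, 1[`; node N16's two letter rows at
`ℓ₃, g, B`; ONE `N16HolderAt … β` sentence per guarded family at the loose-data object (`h16`); the U3 letter rows; def-W1's four finite-volume kernel letters of record — gen 3's
`stub1Text_of_rows` (p608315) with the slot-keyed conjunct: minted all-pins reading (letters `1, 0, 1, 1, 0, …`), guard from the pins, selector `0`, and the transferred bill above.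
The `∃ 𝔯`, the `KeyedLive` guard, the window AND THE VERSION SLOT cost NOTHING; every estimate row stays a displayed HYPOTHESIS (inhabited for no family today).  NOT a proof of the stub (no
`--workitem`, no stub credit: the rows are hypotheses). [bookkeeping] -/
theorem stub1TextV_of_rows :
    ∃ β : ℝ, 2 / 3 < β ∧ β < 1 ∧
    ∃ (𝔯 : RateReading₁₃CoPH 2) (ksel : RunSel) (ℓ : LetterReading) (ℓ₃ : T4Family → Node00.NE3Letters₁₁) (g B : T4Family → ℝ),
      GuardedReadingN16 𝔯 ksel ℓ ℓ₃ g B ∧ KeyedRatesHolderD4V β (rrOfRecord 𝔯 ksel) := by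
  obtain ⟨𝔯, h1, h2, h3, hpL⟩ := exists_reading_v5pins 1 0 1 1 0 0 0 0 0 0 ℓ ℓ₃ B one_pos le_rfl one_pos one_pos
  have hG : GuardedReadingN16 𝔯 (fun _ _ _ _ _ => 0) ℓ ℓ₃ g B := (guardedReadingN16_iff_pins_letterRows _ ℓ ℓ₃ g B).2 ⟨⟨h1, h2, h3, hpL⟩, hE, hM⟩
  exact ⟨β, hβ, hβ', 𝔯, fun _ _ _ _ _ => 0, ℓ, ℓ₃, g, B, hG,
    keyedRatesHolderD4V_rrOfRecord_of_pins_of_letters 𝔯 (fun _ _ _ _ _ => 0) ℓ ℓ₃ g B β s h16 hs hκ hcr hρ hL h9 hW hS hG⟩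

/-- **K3⁸ BY NAME FROM STUB 1's ROWS AND v6 STUB 2's TEXT** (`K3V6Defs.spineGivenEndpointR13SepCoPHV_of_stubTextsV` ∘ `stub1TextV_of_rows`): the item at every version slot costs exactly the
rows above and the REGISTERED `stub_expansion13HV` text.  Every row a HYPOTHESIS; NOT a proof of either stub; K3⁸ OPEN. [bookkeeping] -/
theorem spineGivenEndpointR13SepCoPHV_of_rows_of_stub2TextV
    (h₂ : ∀ β : ℝ, 2 / 3 < β → β < 1 →
    ∀ (𝔯 : RateReading₁₃CoPH 2) (ksel : RunSel) (ℓ : LetterReading) (ℓ₃ : T4Family → Node00.NE3Letters₁₁) (g B : T4Family → ℝ),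
      GuardedReadingN16 𝔯 ksel ℓ ℓ₃ g B → KeyedRatesHolderD4V β (rrOfRecord 𝔯 ksel) →
      ∃ (jc : CutReading) (sh : ShellSplit₁₃CoPH 2 0) (cr : SpineReading), PinnedAtLive jc sh cr ∧
        KeyedRelWeight cr ∧ KeyedShellWeight cr ∧ KeyedExtractionV cr ∧ KeyedCoreEdgeHolderD4V β cr (rrOfRecord 𝔯 ksel)) :
    Summit.QuantumFields.YangMills.Theses.BalabanUVNodes.SpineGivenEndpointR13SepCoPHV :=
  spineGivenEndpointR13SepCoPHV_of_stubTextsV (stub1TextV_of_rows ℓ ℓ₃ g B β s h16 hs hκ hcr hρ hL h9 hW hS hβ hβ' hE hM) h₂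

end Rows

end Summit.QuantumFields.YangMills.Theorems.K3V6Defs
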